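import Mathlib.Combinatorics.SetFamily.FourFunctions
import Literature.Computability.Complexity.Rossman2008CliqueProofs
import Literature.Computability.Complexity.RossmanMonotoneClique
import HarnessLib

/-!
# Harris' inequality for the binomial random graph `G(n,p)` (finite-sum model)

T. E. Harris' correlation inequality (1960; the product-measure case of the FKG inequality of
Fortuin–Kasteleyn–Ginibre 1971): decreasing events of `G(n,p)` are positively correlated,
`Pr[D₁ ∩ D₂] ≥ Pr[D₁] Pr[D₂]`, hence `Pr[⋂ᵢ Dᵢ] ≥ ∏ᵢ Pr[Dᵢ]`. This is the tool Rossman invokes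
in the proof of Lemma 23 (a) ("by Harris' Theorem", FOCS 2010, Appendix B, p. 14) and, implicitly,
behind "`Pr[ω_k(G) = 0] ≥ Ω(1)` (since `p` is a threshold function)" in the proof of Lemma 17
[Rossman2010]; we use it for the non-degeneracy of `ω_k` at the threshold
(`CliqueThresholdBounds.lean`).

Everything is PROVED, in the finite-sum vocabulary of `Rossman2008.lean` /
`RossmanMonotoneClique.lean` (edge vectors `x : E(K_n) → Bool` with the pointwise order, so that
`H ⊆ G` is `x ≤ y`; `gnpWeight`, `gnpProb`):

* `gnpWeight_mul_gnpWeight_eq` — the `G(n,p)` weights are log-modular,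
  `w(x) w(y) = w(x ∧ y) w(x ∨ y)` (a product measure);
* `gnpProb_inter_ge_of_antitone` — **Harris' inequality** for two decreasing events, obtained from
  Mathlib's `fkg` (the Fortuin–Kasteleyn–Ginibre inequality on a finite distributive lattice)
  applied to the order dual of the cube `E(K_n) → Bool`;
* `prod_gnpProb_le_gnpProb_forall` — its iteration over a finite family of decreasing events;
* `exp_neg_two_mul_sum_le_prod_one_sub` — the elementary bound `∏ᵢ (1 - qᵢ) ≥ exp(-2 Σᵢ qᵢ)` for
  `qᵢ ∈ [0, 1/2]` used to evaluate Harris products.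

## References

* T. E. Harris, A lower bound for the critical probability in a certain percolation process,
  Proc. Cambridge Philos. Soc. 56 (1960) 13–20 (Lemma 4.1).
* [Rossman2010] B. Rossman, The monotone complexity of k-clique on random graphs, FOCS 2010 /
  SIAM J. Comput. 43 (2014), Appendix B.
* N. Alon, J. Spencer, The Probabilistic Method, Ch. 6 (FKG / Harris–Kleitman).
-/

noncomputable section

namespace Literature.Computability.Complexity

open Finset

variable {n : ℕ}

/-! ### Log-modularity of the product weights -/

/-- One-edge weights are log-modular on `Bool`: `φ(a) φ(b) = φ(a ∧ b) φ(a ∨ b)`. [folklore] -/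
theorem oneEdge_mul_oneEdge_eq (q : ℝ) (a b : Bool) :
    (if a = true then q else 1 - q) * (if b = true then q else 1 - q) =
      (if (a && b) = true then q else 1 - q) * (if (a || b) = true then q else 1 - q) := by
  cases a <;> cases b <;> simp [mul_comm]

/-- **The `G(n,p)` weights are log-modular** (indeed modular in the exponent: `e(x) + e(y) =
e(x ∧ y) + e(x ∨ y)`): `w(x) w(y) = w(x ∧ y) w(x ∨ y)` for all edge vectors `x, y` — the
hypothesis of the FKG inequality, with equality, as for every product measure. [folklore] -/
theorem gnpWeight_mul_gnpWeight_eq (q : ℝ) (x y : (⊤ : SimpleGraph (Fin n)).edgeSet → Bool) :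
    gnpWeight n q x * gnpWeight n q y = gnpWeight n q (x ⊓ y) * gnpWeight n q (x ⊔ y) := by
  rw [gnpWeight_eq_prod, gnpWeight_eq_prod, gnpWeight_eq_prod, gnpWeight_eq_prod,
    ← prod_mul_distrib, ← prod_mul_distrib]
  refine prod_congr rfl fun e _ => ?_
  rw [oneEdge_mul_oneEdge_eq q (x e) (y e)]
  rfl

/-- `Pr[P]` as a weighted sum of the indicator of `P`. [folklore] -/
theorem gnpProb_filter_eq_sum_mul_ite (q : ℝ)
    (P : ((⊤ : SimpleGraph (Fin n)).edgeSet → Bool) → Prop) [DecidablePred P] :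
    gnpProb n q (univ.filter P) = ∑ x, gnpWeight n q x * (if P x then 1 else 0) := by
  rw [gnpProb, sum_filter]
  refine sum_congr rfl fun x _ => ?_
  split_ifs <;> simp

/-! ### Harris' inequality -/

/-- **Harris' inequality** (Harris 1960; the product-measure case of FKG): two DECREASING events
of `G(n,p)`, `p ∈ [0,1]`, are positively correlated, `Pr[P] · Pr[Q] ≤ Pr[P ∧ Q]`. Derived from
Mathlib's `fkg` on the order dual of the distributive lattice `E(K_n) → Bool`, where the weights
`gnpWeight n p` are log-modular (`gnpWeight_mul_gnpWeight_eq`) and of total mass `1`. This is the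
"Harris' Theorem" of Rossman 2010, App. B. [cite: Rossman2010, App. B (proof of Lemma 23 (a), p. 14)] -/
theorem gnpProb_inter_ge_of_antitone {p : ℝ} (hp0 : 0 ≤ p) (hp1 : p ≤ 1)
    (P Q : ((⊤ : SimpleGraph (Fin n)).edgeSet → Bool) → Prop) [DecidablePred P] [DecidablePred Q]
    (hP : ∀ x y, x ≤ y → P y → P x) (hQ : ∀ x y, x ≤ y → Q y → Q x) :
    gnpProb n p (univ.filter P) * gnpProb n p (univ.filter Q) ≤
      gnpProb n p (univ.filter fun x => P x ∧ Q x) := by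
  classical
  -- the data of `fkg` on the order dual of the cube
  let α := ((⊤ : SimpleGraph (Fin n)).edgeSet → Bool)ᵒᵈ
  let μ : α → ℝ := fun a => gnpWeight n p (OrderDual.ofDual a)
  let f : α → ℝ := fun a => if P (OrderDual.ofDual a) then 1 else 0
  let g : α → ℝ := fun a => if Q (OrderDual.ofDual a) then 1 else 0
  have hμ₀ : 0 ≤ μ := fun a => gnpWeight_nonneg hp0 hp1 _
  have hf₀ : 0 ≤ f := fun a => by simp only [f, Pi.zero_apply]; split_ifs <;> norm_num
  have hg₀ : 0 ≤ g := fun a => by simp only [g, Pi.zero_apply]; split_ifs <;> norm_num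
  have hf : Monotone f := by
    intro a b hab
    have hba : OrderDual.ofDual b ≤ OrderDual.ofDual a := OrderDual.ofDual_le_ofDual.2 hab
    simp only [f]
    by_cases ha : P (OrderDual.ofDual a)
    · rw [if_pos ha, if_pos (hP _ _ hba ha)]
    · rw [if_neg ha]; split_ifs <;> norm_num
  have hg : Monotone g := by
    intro a b hab
    have hba : OrderDual.ofDual b ≤ OrderDual.ofDual a := OrderDual.ofDual_le_ofDual.2 hab
    simp only [g]
    by_cases ha : Q (OrderDual.ofDual a)
    · rw [if_pos ha, if_pos (hQ _ _ hba ha)]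
    · rw [if_neg ha]; split_ifs <;> norm_num
  have hμ : ∀ a b, μ a * μ b ≤ μ (a ⊓ b) * μ (a ⊔ b) := by
    intro a b
    simp only [μ]
    rw [gnpWeight_mul_gnpWeight_eq, mul_comm]
    exact le_rfl
  have key := fkg f g μ hμ₀ hf₀ hg₀ hf hg hμ
  -- read the four sums back on the cube
  have hmass : ∑ a, μ a = 1 := sum_gnpWeight (n := n) p
  have hPsum : ∑ a, μ a * f a = gnpProb n p (univ.filter P) := (gnpProb_filter_eq_sum_mul_ite p P).symm
  have hQsum : ∑ a, μ a * g a = gnpProb n p (univ.filter Q) := (gnpProb_filter_eq_sum_mul_ite p Q).symm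
  have hPQsum : ∑ a, μ a * (f a * g a) = gnpProb n p (univ.filter fun x => P x ∧ Q x) := by
    rw [gnpProb_filter_eq_sum_mul_ite p (fun x => P x ∧ Q x)]
    refine sum_congr rfl fun a _ => ?_
    simp only [μ, f, g, ite_zero_mul_ite_zero, one_mul]
    rfl
  rw [hmass, one_mul, hPsum, hQsum, hPQsum] at key
  exact key

/-- **Harris' inequality for a finite family** of decreasing events of `G(n,p)`, `p ∈ [0,1]`:
`∏_{i ∈ s} Pr[Dᵢ] ≤ Pr[⋂_{i ∈ s} Dᵢ]` (induction on `s` from the two-event case). Used with the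
decreasing events `Dᵢ = {K_{Bᵢ} ⊈ G}` as in Rossman 2010, App. B.
[cite: Rossman2010, App. B (proof of Lemma 23 (a), p. 14)] -/
theorem prod_gnpProb_le_gnpProb_forall {ι : Type*} {p : ℝ} (hp0 : 0 ≤ p) (hp1 : p ≤ 1)
    (s : Finset ι) (D : ι → ((⊤ : SimpleGraph (Fin n)).edgeSet → Bool) → Prop)
    [∀ i, DecidablePred (D i)] (hD : ∀ i ∈ s, ∀ x y, x ≤ y → D i y → D i x) :
    ∏ i ∈ s, gnpProb n p (univ.filter (D i)) ≤
      gnpProb n p (univ.filter fun x => ∀ i ∈ s, D i x) := by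
  classical
  induction s using Finset.induction_on with
  | empty =>
    rw [prod_empty]
    have : (univ.filter fun x : (⊤ : SimpleGraph (Fin n)).edgeSet → Bool => ∀ i ∈ (∅ : Finset ι), D i x) =
        univ := filter_true_of_mem fun x _ i hi => absurd hi (Finset.notMem_empty i)
    rw [this, gnpProb_univ]
  | insert a s ha ih =>
    rw [prod_insert ha]
    have hD' : ∀ i ∈ s, ∀ x y, x ≤ y → D i y → D i x := fun i hi => hD i (mem_insert_of_mem hi)
    have hanti : ∀ x y : (⊤ : SimpleGraph (Fin n)).edgeSet → Bool, x ≤ y →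
        (∀ i ∈ s, D i y) → ∀ i ∈ s, D i x := fun x y hxy h i hi => hD' i hi x y hxy (h i hi)
    calc gnpProb n p (univ.filter (D a)) * ∏ i ∈ s, gnpProb n p (univ.filter (D i))
        ≤ gnpProb n p (univ.filter (D a)) * gnpProb n p (univ.filter fun x => ∀ i ∈ s, D i x) :=
          mul_le_mul_of_nonneg_left (ih hD') (gnpProb_nonneg hp0 hp1 _)
      _ ≤ gnpProb n p (univ.filter fun x => D a x ∧ ∀ i ∈ s, D i x) :=
          gnpProb_inter_ge_of_antitone hp0 hp1 (D a) _ (hD a (mem_insert_self a s)) hanti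
      _ = gnpProb n p (univ.filter fun x => ∀ i ∈ insert a s, D i x) := by
          congr 1
          refine filter_congr fun x _ => ?_
          simp only [forall_mem_insert]

/-! ### Evaluating Harris products -/

/-- `exp(-2 Σ_{i∈s} qᵢ) ≤ ∏_{i∈s} (1 - qᵢ)` for `qᵢ ∈ [0, 1/2]` (termwise `e^{-2q} ≤ 1 - q`, from
`1 + 2q ≤ e^{2q}` and `(1 - q)(1 + 2q) ≥ 1`): the lower bound used to evaluate Harris products
`∏ (1 - Pr[K_B ⊆ G])`. [folklore] -/
theorem exp_neg_two_mul_sum_le_prod_one_sub {ι : Type*} (s : Finset ι) (q : ι → ℝ)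
    (hq0 : ∀ i ∈ s, 0 ≤ q i) (hq : ∀ i ∈ s, q i ≤ 1 / 2) :
    Real.exp (-(2 * ∑ i ∈ s, q i)) ≤ ∏ i ∈ s, (1 - q i) := by
  have hone : ∀ t : ℝ, 0 ≤ t → t ≤ 1 / 2 → Real.exp (-(2 * t)) ≤ 1 - t := by
    intro t ht0 ht
    have h1 : 2 * t + 1 ≤ Real.exp (2 * t) := Real.add_one_le_exp _
    have h2 : 0 < Real.exp (2 * t) := Real.exp_pos _
    rw [Real.exp_neg, inv_le_iff_one_le_mul₀ h2]
    nlinarith [mul_nonneg ht0 (show 0 ≤ 1 - 2 * t by linarith)]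
  rw [mul_sum, ← sum_neg_distrib, Real.exp_sum]
  exact prod_le_prod (fun i _ => (Real.exp_pos _).le) fun i hi => hone (q i) (hq0 i hi) (hq i hi)

end Literature.Computability.Complexity

end
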